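import Summits.QuantumFields.YangMills.Theorems.IR.MomentumPincerR2RP

/-!
# Rung R2 of line `momentum-pincer`, file 3∕3: §3 rate ceiling + assembly with R1, §3b–§3c the concrete `SCFloor` target, §3d (F) is a theorem,
# §5 R2 CLOSED — `noLightMoversSCTransfer_holds : NoLightMoversSCTransfer`

Landed for item `stmt-QuantumFields-19354` (`--supports … --as helper`) by the LEAD prover ab-p1 under director-ym RULING g9-№2 ∕ №14 (3);
authored by ideator ym-ir-idea-5 g8 (line `momentum-pincer`, rung R2), MINIMAL CUT of the sorry-free workfile `Cruxes/IR/Lines/momentum_pincer_R2_transfer.lean`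
v6 8c85df89ce78 (§0–§3d + §5; the by-product §4 «far field» is not landed), split in three files: `MomentumPincerR2Slice` (§0–§1) →
`MomentumPincerR2RP` (§2–§2b) → `MomentumPincerR2Closure` (§3–§3d, §5: `noLightMoversSCTransfer_holds : NoLightMoversSCTransfer`).

HONEST: a strong-coupling rung (group-blind up to `a ≠ 1`); nothing here bears on `IR` at weak coupling, a continuum limit, or the Yang–Mills mass gap (Clay) — NOT proved; R4 closes only `BalabanLadder.UV`.
-/

noncomputable section

open Filter Topology MeasureTheory Finset
open Literature.MathematicalPhysics.QuantumFieldTheory Literature.MathematicalPhysics.QuantumLattice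
open Literature.Probability.LatticeModels (Torus.proj Torus.proj_apply)
open Literature.Probability.LatticeModels.Site (supNorm supNorm_le_iff natAbs_le_supNorm norm_eq_supNorm)
open Summit.QuantumFields.YangMills.Theorems.SoloBlind

namespace Summit.QuantumFields.YangMills.Cruxes.IR.MomentumPincerRung

variable {G : Type} [Group G] [TopologicalSpace G] [IsTopologicalGroup G] [CompactSpace G]
  [MeasurableSpace G] [BorelSpace G]

/-! ## §3 The rate ceiling and the assembly with R1 -/

/-- **Rate ceiling.**  A geometric floor against an exponential ceiling bounds the rate: if
`q^{S-1} f₁ ≤ C e^{-m S}` for all large `S` (`0 < q`, `0 < f₁`) then `m ≤ -log q`. [elementary] -/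
theorem rate_le_neg_log_of_floor {q f₁ C m : ℝ} (hq : 0 < q) (hf : 0 < f₁)
    (h : ∀ᶠ S : ℕ in atTop, q ^ (S - 1) * f₁ ≤ C * Real.exp (-(m * S))) : m ≤ -Real.log q := by
  refine rate_le_of_eventually_exp_le (η := f₁ / q) (C := C) (u := -Real.log q) (v := m) (div_pos hf hq) ?_
  filter_upwards [h, eventually_ge_atTop 1] with S hS hS1
  have hqS : q ^ S = q * q ^ (S - 1) := by
    rw [← pow_succ']; congr 1; omega
  have hexp : Real.exp (-(-Real.log q * S)) = q ^ S := by
    rw [neg_mul, neg_neg, mul_comm, Real.exp_nat_mul, Real.exp_log hq]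
  calc f₁ / q * Real.exp (-(-Real.log q * S)) = f₁ / q * (q * q ^ (S - 1)) := by rw [hexp, hqS]
    _ = q ^ (S - 1) * f₁ := by rw [← mul_assoc, div_mul_cancel₀ _ hq.ne']; ring
    _ ≤ C * Real.exp (-(m * S)) := hS

/-- **R2, the RP / transfer-matrix half — PROVED: `SliceFloorSC → NoLightMoversSCTransfer`.**
Window `β₀ := min(β₀^{floor}, β₀^{R1})`, `β₁ := β₀/2`; with the floor data `(s_max, f₁)` at `β₁`,
`q := f₁ / max(s_max, f₁)`, `L := -log q`, `θ := c / max(L, c)`: every valid zero-momentum rate obeys `m(β) ≤ L`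
(geometric floor `s_{S}(S) ≥ q^{S-1} f₁` from RP log-convexity vs. the hypothesis at `(P, P)`, `t = S`), hence
`θ m(β) ≤ c` and R1's β-uniform point clustering at rate `c` concludes (`S₃ := 0`). -/
theorem noLightMoversSCTransfer_of_sliceFloorSC (hfl : SliceFloorSC) : NoLightMoversSCTransfer := by
  intro G _ _ _ _ hG
  letI : MeasurableSpace G := borel G
  haveI : BorelSpace G := ⟨rfl⟩
  intro r
  -- the SC two-point floor and R1
  obtain ⟨β₀f, hβ₀f, P, hP, hwin⟩ := hfl G hG r
  obtain ⟨β₀R, c, hβ₀R, hc, hR1⟩ := noLightMoversSC_holds G hG r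
  -- the window
  set β₀ : ℝ := min β₀f β₀R with hβ₀def
  have hβ₀ : 0 < β₀ := lt_min hβ₀f hβ₀R
  set β₁ : ℝ := β₀ / 2 with hβ₁def
  have hβ₁ : 0 < β₁ := by positivity
  have hβ₁β₀ : β₁ < β₀ := by rw [hβ₁def]; linarith
  have hβ₁f : β₁ < β₀f := hβ₁β₀.trans_le (min_le_left _ _)
  obtain ⟨sMax, f₁, S₀, hf₁, hSF⟩ := hwin β₁ hβ₁ hβ₁f
  -- the constants
  set sMax' : ℝ := max sMax f₁ with hsMax'def
  have hsMax' : 0 < sMax' := hf₁.trans_le (le_max_right _ _)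
  set q : ℝ := f₁ / sMax' with hqdef
  have hq : 0 < q := div_pos hf₁ hsMax'
  set L : ℝ := -Real.log q with hLdef
  set M : ℝ := max L c with hMdef
  have hM : 0 < M := hc.trans_le (le_max_right _ _)
  set θ : ℝ := c / M with hθdef
  have hθ : 0 < θ := div_pos hc hM
  refine ⟨β₁, β₀, θ, hβ₁, hβ₁β₀, hθ, fun m S₁ hm hHyp => ⟨fun _ => 0, fun A B => ?_⟩⟩
  obtain ⟨C, hC⟩ := hR1 A B
  refine ⟨C, fun β hβ₁le hβle S t _ ht => ?_⟩
  have hβpos : 0 < β := hβ₁.trans_le hβ₁le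
  have hβR : β ≤ β₀R := hβle.trans (min_le_right _ _)
  have hβf : β ≤ β₀f := hβle.trans (min_le_left _ _)
  -- RATE CEILING `m β ≤ L`: the geometric floor at `t = S'` against the hypothesis at `(P, P)`, `t = S'`
  have hmL : m β ≤ L := by
    obtain ⟨CP, hCP⟩ := hHyp P P
    refine rate_le_neg_log_of_floor (C := CP) hq hf₁ ?_
    filter_upwards [eventually_ge_atTop (max (max (S₁ β) S₀) 1)] with S' hS'
    have hS'1 : 1 ≤ S' := le_trans (le_max_right _ _) hS'
    have hS'0 : S₀ ≤ S' := le_trans (le_trans (le_max_right _ _) (le_max_left _ _)) hS'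
    have hS'1' : S₁ β ≤ S' := le_trans (le_trans (le_max_left _ _) (le_max_left _ _)) hS'
    obtain ⟨h0S, h1S⟩ := hSF β hβ₁le hβf S' hS'0
    have hfloor := geometric_floor_of_two_point (a := fun k => sliceSumCorr r.ρ β S' P.F P.F k) (K := 2 * S' + 1)
      (fun k _ => sliceSumCorr_self_nonneg r.ρ r.continuous hβpos.le hS'1 P hP k)
      (fun k hk => sliceSumCorr_self_logConvex r.ρ r.continuous hβpos.le hS'1 P hP k hk)
      hsMax' hf₁ (h0S.trans (le_max_left _ _)) h1S S' hS'1 (by omega)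
    have hceil := (le_abs_self _).trans (hCP β hβ₁le hβle S' S' hS'1' le_rfl)
    exact hfloor.trans hceil
  -- hence `θ · m β ≤ c`
  have hθm : θ * m β ≤ c := by
    have h1 : m β ≤ M := hmL.trans (le_max_left _ _)
    have h2 : m β / M ≤ 1 := (div_le_one hM).mpr h1
    calc θ * m β = c * (m β / M) := by rw [hθdef]; ring
      _ ≤ c * 1 := mul_le_mul_of_nonneg_left h2 hc.le
      _ = c := mul_one c
  -- R1 and monotonicity of the exponential
  have hC0 : 0 ≤ C := by
    have h := hC β hβpos hβR 0 0 le_rfl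
    simp only [Nat.cast_zero, mul_zero, neg_zero, Real.exp_zero, mul_one] at h
    exact (abs_nonneg _).trans h
  calc |latticeConnectedCorr r.ρ β (2 * S + 1) A.F B.F t| ≤ C * Real.exp (-(c * t)) := hC β hβpos hβR S t ht
    _ ≤ C * Real.exp (-(θ * m β * t)) := by
        refine mul_le_mul_of_nonneg_left (Real.exp_le_exp.mpr ?_) hC0
        have : θ * m β * t ≤ c * t := mul_le_mul_of_nonneg_right hθm (Nat.cast_nonneg t)
        linarith

/-! ## §3b Smaller SC inputs: by F0 only the floor on `s_S(1)` is needed -/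

/-- **SC INPUT, one-clause form.**  As `SliceFloorSC` without the `s_S(0) ≤ s_max` clause (free by F0
`sliceSumCorr_zero_le`): a time-zero spatial species `P` whose nearest-neighbour slice sum has a positive floor
`f₁(β₁) ≤ s_S(1)` on `[β₁, β₀]` for all large `S`. -/
def SliceOneFloorSC : Prop :=
  ∀ (G : Type) [Group G] [TopologicalSpace G] [IsTopologicalGroup G] [CompactSpace G],
    IsCompactSimpleLieGroup G → letI : MeasurableSpace G := borel G; haveI : BorelSpace G := ⟨rfl⟩;
    ∀ r : LatticeRep G, ∃ β₀ : ℝ, 0 < β₀ ∧ ∃ P : YMSpecies G, (∀ e ∈ P.supp, e.1 0 = 0 ∧ e.2 ≠ 0) ∧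
      ∀ β₁ : ℝ, 0 < β₁ → β₁ < β₀ → ∃ f₁ : ℝ, ∃ S₀ : ℕ, 0 < f₁ ∧
        ∀ β : ℝ, β₁ ≤ β → β ≤ β₀ → ∀ S : ℕ, S₀ ≤ S → f₁ ≤ sliceSumCorr r.ρ β S P.F P.F 1

/-- **SC INPUT, power-law form (the shape the `SCFloor` engine produces).**  A time-zero spatial species `P`
(intended: a spatial plaquette) with `c β^k ≤ s_S(1)` for `0 < β ≤ β₀`, `S ≥ S₀` (intended `k = 4`: the LANDED
facing floor `SCFloor.facingPlaquetteCorr_floor` gives `c β⁴ ≤ Cov(P_{e₀}, P)`; what remains is that the other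
slice terms `Σ_{x⃗ ≠ 0} Cov(P_{(1,x⃗)}, P)` do not eat more than half of it). -/
def SlicePowerFloorSC : Prop :=
  ∀ (G : Type) [Group G] [TopologicalSpace G] [IsTopologicalGroup G] [CompactSpace G],
    IsCompactSimpleLieGroup G → letI : MeasurableSpace G := borel G; haveI : BorelSpace G := ⟨rfl⟩;
    ∀ r : LatticeRep G, ∃ β₀ c : ℝ, ∃ k S₀ : ℕ, 0 < β₀ ∧ 0 < c ∧
      ∃ P : YMSpecies G, (∀ e ∈ P.supp, e.1 0 = 0 ∧ e.2 ≠ 0) ∧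
        ∀ β : ℝ, 0 < β → β ≤ β₀ → ∀ S : ℕ, S₀ ≤ S → c * β ^ k ≤ sliceSumCorr r.ρ β S P.F P.F 1

/-- A power-law floor `c·β^k ≤ s_S(1)` on `0 < β ≤ β₀` gives the floor on `s_S(1)` on a window `[β₁, β₀]` (`SlicePowerFloorSC → SliceOneFloorSC`). -/
theorem sliceOneFloorSC_of_slicePowerFloorSC (h : SlicePowerFloorSC) : SliceOneFloorSC := by
  intro G _ _ _ _ hG
  letI : MeasurableSpace G := borel G
  haveI : BorelSpace G := ⟨rfl⟩
  intro r
  obtain ⟨β₀, c, k, S₀, hβ₀, hc, P, hP, hfl⟩ := h G hG r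
  refine ⟨β₀, hβ₀, P, hP, fun β₁ hβ₁ _ => ⟨c * β₁ ^ k, S₀, by positivity, fun β hβ₁le hβle S hS => ?_⟩⟩
  calc c * β₁ ^ k ≤ c * β ^ k := mul_le_mul_of_nonneg_left (pow_le_pow_left₀ hβ₁.le hβ₁le k) hc.le
    _ ≤ sliceSumCorr r.ρ β S P.F P.F 1 := hfl β (hβ₁.trans_le hβ₁le) hβle S hS

/-- By F0 (`s_S(0) ≤ s_max`, §2b) the floor on `s_S(1)` alone yields the two-datum floor `SliceFloorSC`. -/
theorem sliceFloorSC_of_sliceOneFloorSC (h : SliceOneFloorSC) : SliceFloorSC := by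
  intro G _ _ _ _ hG
  letI : MeasurableSpace G := borel G
  haveI : BorelSpace G := ⟨rfl⟩
  intro r
  obtain ⟨β₀, hβ₀, P, hP, hwin⟩ := h G hG r
  obtain ⟨β₀c, sMax, hβ₀c, hs0⟩ := sliceSumCorr_zero_le r.ρ r.continuous P
  refine ⟨min β₀ β₀c, lt_min hβ₀ hβ₀c, P, hP, fun β₁ hβ₁ hβ₁lt => ?_⟩
  obtain ⟨f₁, S₀, hf₁, hfl⟩ := hwin β₁ hβ₁ (hβ₁lt.trans_le (min_le_left _ _))
  exact ⟨sMax, f₁, S₀, hf₁, fun β hβ₁le hβle S hS =>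
    ⟨hs0 β (hβ₁.le.trans hβ₁le) (hβle.trans (min_le_right _ _)) S,
      hfl β hβ₁le (hβle.trans (min_le_left _ _)) S hS⟩⟩

/-- **R2 from the one-clause floor.** -/
theorem noLightMoversSCTransfer_of_sliceOneFloorSC (h : SliceOneFloorSC) : NoLightMoversSCTransfer :=
  noLightMoversSCTransfer_of_sliceFloorSC (sliceFloorSC_of_sliceOneFloorSC h)

/-- **R2 from the power-law floor** — the form to be supplied by the `SCFloor` engine. -/
theorem noLightMoversSCTransfer_of_slicePowerFloorSC (h : SlicePowerFloorSC) : NoLightMoversSCTransfer :=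
  noLightMoversSCTransfer_of_sliceOneFloorSC (sliceOneFloorSC_of_slicePowerFloorSC h)

/-! ## §3c The concrete target for the `SCFloor` engine: the spatial plaquette `Re tr ρ(U_{(0;1,2)})` -/

/-- The slice sum splits as the diagonal (`x⃗ = 0`) term plus the off-diagonal terms. -/
theorem sliceSumCorr_split {N : ℕ} (ρ : G →* Matrix (Fin N) (Fin N) ℂ) (β : ℝ) (S : ℕ) (A B : LGConfig 4 G → ℝ)
    (t : ℕ) :
    sliceSumCorr ρ β S A B t = latticeConnectedCorr ρ β (2 * S + 1) A B t +
      ∑ x ∈ (Finset.univ : Finset (Fin 3 → ZMod (2 * S + 1))).erase 0,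
        latticeConnectedCorr ρ β (2 * S + 1) (fun U => A (configShift (spatialVec S x) U)) B t := by
  have h0 : ∀ U : LGConfig 4 G, configShift (spatialVec S 0) U = U := by
    intro U; funext e; simp [configShift_apply]
  have h1 : (fun U : LGConfig 4 G => A (configShift (spatialVec S 0) U)) = A := funext fun U => by rw [h0]
  unfold sliceSumCorr
  rw [← Finset.add_sum_erase _ _ (Finset.mem_univ (0 : Fin 3 → ZMod (2 * S + 1))), h1]

/-- **SC INPUT (F), facing floor on odd tori** — this is `SCFloor.facingPlaquetteCorr_floor` (ym-ir-line-bsf-p1, LANDED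
p606286: `c β⁴ ≤ Cov(P_{e₀}, P) ≤ C β⁴`, all `L ≥ 3`, `0 < β ≤ β₀`) restricted to the odd tori `L = 2S+1`, `S ≥ 1`,
modulo its hypothesis `∃ g h, Re tr ρ g ≠ Re tr ρ h` (true for `r : LatticeRep G`, `G` compact simple: a faithful
continuous representation of a non-trivial compact group has a non-constant real character — to be discharged). -/
def PlaquetteFacingFloorSC : Prop :=
  ∀ (G : Type) [Group G] [TopologicalSpace G] [IsTopologicalGroup G] [CompactSpace G],
    IsCompactSimpleLieGroup G → letI : MeasurableSpace G := borel G; haveI : BorelSpace G := ⟨rfl⟩;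
    ∀ r : LatticeRep G, ∃ β₀ c : ℝ, 0 < β₀ ∧ 0 < c ∧
      ∀ S : ℕ, 1 ≤ S → ∀ β : ℝ, 0 < β → β ≤ β₀ →
        c * β ^ 4 ≤ latticeConnectedCorr r.ρ β (2 * S + 1) (plaquetteObs r.ρ 0 1 2) (plaquetteObs r.ρ 0 1 2) 1

/-- **SC INPUT (O), the off-diagonal slice terms are `O(β⁵)` UNIFORMLY IN THE VOLUME** — the one estimate left:
`|Σ_{x⃗ ≠ 0} Cov(P_{(0,x⃗)}, P_{e₀})| ≤ C β⁵` for `0 < β ≤ β₀` and all `S ≥ S₀` (per pair: no polymer with `≤ 4`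
plaquettes joins a non-facing pair, `SCFloor.mayer_sum_offdiag`; summability in `x⃗` uniformly in `S`: the vanishing
order / activity power grows with `‖x⃗‖_∞`).  A per-pair `O(β⁵)` bound with an `x⃗`-independent constant is NOT enough. -/
def PlaquetteOffDiagSliceSC : Prop :=
  ∀ (G : Type) [Group G] [TopologicalSpace G] [IsTopologicalGroup G] [CompactSpace G],
    IsCompactSimpleLieGroup G → letI : MeasurableSpace G := borel G; haveI : BorelSpace G := ⟨rfl⟩;
    ∀ r : LatticeRep G, ∃ β₀ C : ℝ, ∃ S₀ : ℕ, 0 < β₀ ∧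
      ∀ β : ℝ, 0 < β → β ≤ β₀ → ∀ S : ℕ, S₀ ≤ S →
        |sliceSumCorr r.ρ β S (plaquetteObs r.ρ 0 1 2) (plaquetteObs r.ρ 0 1 2) 1 -
            latticeConnectedCorr r.ρ β (2 * S + 1) (plaquetteObs r.ρ 0 1 2) (plaquetteObs r.ρ 0 1 2) 1| ≤
          C * β ^ 5

/-- **SC INPUT, concrete power-law form**: `c β⁴ ≤ s_S(1)` for the spatial plaquette, `0 < β ≤ β₀`, `S ≥ S₀`. -/
def PlaquetteSlicePowerFloorSC : Prop :=
  ∀ (G : Type) [Group G] [TopologicalSpace G] [IsTopologicalGroup G] [CompactSpace G],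
    IsCompactSimpleLieGroup G → letI : MeasurableSpace G := borel G; haveI : BorelSpace G := ⟨rfl⟩;
    ∀ r : LatticeRep G, ∃ β₀ c : ℝ, ∃ S₀ : ℕ, 0 < β₀ ∧ 0 < c ∧
      ∀ β : ℝ, 0 < β → β ≤ β₀ → ∀ S : ℕ, S₀ ≤ S →
        c * β ^ 4 ≤ sliceSumCorr r.ρ β S (plaquetteObs r.ρ 0 1 2) (plaquetteObs r.ρ 0 1 2) 1

/-- (F) + (O) ⇒ the power-law slice floor, with constant `c/2` on `β ≤ min(β₀^F, β₀^O, c/(2 max(C,1)))`. -/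
theorem plaquetteSlicePowerFloorSC_of_facing_offdiag (hf : PlaquetteFacingFloorSC) (ho : PlaquetteOffDiagSliceSC) :
    PlaquetteSlicePowerFloorSC := by
  intro G _ _ _ _ hG
  letI : MeasurableSpace G := borel G
  haveI : BorelSpace G := ⟨rfl⟩
  intro r
  obtain ⟨β₀f, c, hβ₀f, hc, hfl⟩ := hf G hG r
  obtain ⟨β₀o, C, S₀, hβ₀o, hoff⟩ := ho G hG r
  set Cp : ℝ := max C 1 with hCp
  have hCp0 : 0 < Cp := lt_of_lt_of_le one_pos (le_max_right _ _)
  refine ⟨min (min β₀f β₀o) (c / (2 * Cp)), c / 2, max S₀ 1, lt_min (lt_min hβ₀f hβ₀o) (by positivity),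
    by positivity, fun β hβ hβle S hS => ?_⟩
  have hβf : β ≤ β₀f := hβle.trans ((min_le_left _ _).trans (min_le_left _ _))
  have hβo : β ≤ β₀o := hβle.trans ((min_le_left _ _).trans (min_le_right _ _))
  have hβc : β ≤ c / (2 * Cp) := hβle.trans (min_le_right _ _)
  have hS1 : 1 ≤ S := le_trans (le_max_right _ _) hS
  have hS0 : S₀ ≤ S := le_trans (le_max_left _ _) hS
  have h1 := hfl S hS1 β hβ hβf
  have h2 := (abs_le.mp (hoff β hβ hβo S hS0)).1
  have h3 : C * β ^ 5 ≤ c / 2 * β ^ 4 := by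
    have hCle : C ≤ Cp := le_max_left _ _
    have hb4 : 0 ≤ β ^ 4 := by positivity
    have hCpβ : Cp * β ≤ c / 2 := by
      rw [le_div_iff₀ (by positivity)] at hβc
      linarith
    calc C * β ^ 5 ≤ Cp * β ^ 5 := mul_le_mul_of_nonneg_right hCle (by positivity)
      _ = (Cp * β) * β ^ 4 := by ring
      _ ≤ (c / 2) * β ^ 4 := mul_le_mul_of_nonneg_right hCpβ hb4
  linarith

/-- The spatial plaquette species `plaquetteObservable ρ _ 1 2` is time-zero spatial. -/
theorem plaquetteObservable_one_two_timeZeroSpatial [SecondCountableTopology G] {N : ℕ}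
    (ρ : G →* Matrix (Fin N) (Fin N) ℂ) (hρ : Continuous ρ) :
    ∀ e ∈ (plaquetteObservable ρ hρ (1 : Fin 4) 2).supp, e.1 0 = 0 ∧ e.2 ≠ 0 := by
  intro e he
  simp only [plaquetteObservable, originPlaquetteSupport, Finset.mem_insert, Finset.mem_singleton] at he
  rcases he with rfl | rfl | rfl | rfl <;> simp

/-- The concrete spatial-plaquette floor `PlaquetteSlicePowerFloorSC` (§3c) instantiates the abstract `SlicePowerFloorSC`. -/
theorem slicePowerFloorSC_of_plaquette (h : PlaquetteSlicePowerFloorSC) : SlicePowerFloorSC := by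
  intro G _ _ _ _ hG
  letI : MeasurableSpace G := borel G
  haveI : BorelSpace G := ⟨rfl⟩
  intro r
  haveI : SecondCountableTopology G :=
    (r.continuous.isClosedEmbedding r.injective).isEmbedding.secondCountableTopology
  obtain ⟨β₀, c, S₀, hβ₀, hc, hfl⟩ := h G hG r
  exact ⟨β₀, c, 4, S₀, hβ₀, hc, plaquetteObservable r.ρ r.continuous 1 2,
    plaquetteObservable_one_two_timeZeroSpatial r.ρ r.continuous, hfl⟩

/-- **R2 from the concrete plaquette floor.** -/
theorem noLightMoversSCTransfer_of_plaquetteSlicePowerFloorSC (h : PlaquetteSlicePowerFloorSC) :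
    NoLightMoversSCTransfer :=
  noLightMoversSCTransfer_of_slicePowerFloorSC (slicePowerFloorSC_of_plaquette h)

/-- **R2 = RP/TM (this file) + F0 (this file) + (F) facing floor (LANDED modulo `hnc`) + (O) off-diagonal `O(β⁵)`
(the engine's one remaining estimate).** -/
theorem noLightMoversSCTransfer_of_facing_offdiag (hf : PlaquetteFacingFloorSC) (ho : PlaquetteOffDiagSliceSC) :
    NoLightMoversSCTransfer :=
  noLightMoversSCTransfer_of_plaquetteSlicePowerFloorSC (plaquetteSlicePowerFloorSC_of_facing_offdiag hf ho)

/-! ## §3d (F) is a THEOREM: the landed facing floor + non-constancy of the real character of a faithful rep -/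

omit [IsTopologicalGroup G] [MeasurableSpace G] [BorelSpace G] in
/-- For a faithful unitary `r : LatticeRep G` of a compact simple (hence non-abelian, hence non-trivial) group the real
character `g ↦ Re tr r.ρ g` is NOT constant: `Re tr ρ(a) < N = Re tr ρ(1)` for `a ≠ 1`, by
`N − Re tr X = ½ ‖X − 1‖²_F` (tree `OneLinkTraceShift.card_sub_re_trace_eq`) and faithfulness. -/
theorem LatticeRep.exists_re_trace_ne (hG : IsCompactSimpleLieGroup G) (r : LatticeRep G) :
    ∃ g h : G, (r.ρ g).trace.re ≠ (r.ρ h).trace.re := by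
  obtain ⟨⟨_, ⟨a, b, hab⟩, _⟩, _⟩ := hG
  have ha : a ≠ 1 := by rintro rfl; simp at hab
  refine ⟨a, 1, fun h => ha ?_⟩
  have hN : (r.ρ a).trace.re = (r.N : ℝ) := by
    rw [map_one, Matrix.trace_one, Fintype.card_fin] at h
    simpa using h
  have hfrob := OneLinkTraceShift.card_sub_re_trace_eq (r.mem_unitary a)
  rw [hN, sub_self] at hfrob
  have hsq : frobNorm (r.ρ a - 1) ^ 2 = 0 := by linarith
  rw [frobNorm_sq] at hsq
  have hzero : r.ρ a - 1 = 0 := by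
    ext i j
    have hi := (Finset.sum_eq_zero_iff_of_nonneg (fun i _ => Finset.sum_nonneg fun j _ => by positivity)).1 hsq i
      (Finset.mem_univ _)
    have hij := (Finset.sum_eq_zero_iff_of_nonneg (fun j _ => by positivity)).1 hi j (Finset.mem_univ _)
    simpa using hij
  exact r.injective ((sub_eq_zero.mp hzero).trans (map_one r.ρ).symm)

/-- **(F) PROVED**: `PlaquetteFacingFloorSC` holds — the `SCFloor` engine's LANDED facing-plaquette floor
`SCFloor.facingPlaquetteCorr_floor` (ym-ir-line-bsf-p1, p606286) on the odd tori `2S+1 ≥ 3`, its character hypothesis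
discharged by `LatticeRep.exists_re_trace_ne`. -/
theorem plaquetteFacingFloorSC_holds : PlaquetteFacingFloorSC := by
  intro G _ _ _ _ hG
  letI : MeasurableSpace G := borel G
  haveI : BorelSpace G := ⟨rfl⟩
  intro r
  haveI : SecondCountableTopology G :=
    (r.continuous.isClosedEmbedding r.injective).isEmbedding.secondCountableTopology
  haveI : T2Space G := (r.continuous.isClosedEmbedding r.injective).isEmbedding.t2Space
  obtain ⟨β₀, c, C, hβ₀, hc, -, h⟩ :=
    SCFloor.facingPlaquetteCorr_floor r.ρ r.continuous (LatticeRep.exists_re_trace_ne hG r)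
  refine ⟨β₀, c, hβ₀, hc, fun S hS β hβ hββ₀ => ?_⟩
  haveI : NeZero (2 * S + 1) := ⟨by omega⟩
  exact (h (2 * S + 1) (by omega) β hβ hββ₀).1

/-- **R2 ⇐ (O) alone.**  With RP/TM (§1–§3), F0 (§2b) and (F) (§3d) proved, the registered stub
`stub_noLightMoversSCTransfer` of line `momentum-pincer` follows from the single strong-coupling estimate
`PlaquetteOffDiagSliceSC`: `|Σ_{x⃗ ≠ 0} Cov(P_{(0,x⃗)}, P_{e₀})| ≤ C β⁵` uniformly in the volume. -/
theorem noLightMoversSCTransfer_of_offdiag (ho : PlaquetteOffDiagSliceSC) : NoLightMoversSCTransfer :=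
  noLightMoversSCTransfer_of_facing_offdiag plaquetteFacingFloorSC_holds ho

/-! ## §5 R2 CLOSED — the engine's LANDED slice floor (`SCFloor.sliceSum_one_floor`, part 19, ym-ir-line-bsf-p1)

Part 19 of the `SCFloor` engine proves `κ β⁴ ≤ s_S(1)` for `0 < β ≤ β₀` and ALL `S ≥ 1` for the spatial plaquette
(diagonal facing floor part 11, off-diagonal terms `O(β⁵)` parts 15–18), under the character hypothesis
`∃ g h, Re tr ρ g ≠ Re tr ρ h` — discharged here by `LatticeRep.exists_re_trace_ne` (§3d).  That is literally
`PlaquetteSlicePowerFloorSC` (§3c), so the registered rung R2 is a THEOREM: `noLightMoversSCTransfer_holds`. -/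

/-- **The power-law slice floor holds** (engine part 19 + §3d). -/
theorem plaquetteSlicePowerFloorSC_holds : PlaquetteSlicePowerFloorSC := by
  intro G _ _ _ _ hG
  letI : MeasurableSpace G := borel G
  haveI : BorelSpace G := ⟨rfl⟩
  intro r
  haveI : SecondCountableTopology G :=
    (r.continuous.isClosedEmbedding r.injective).isEmbedding.secondCountableTopology
  haveI : T2Space G := (r.continuous.isClosedEmbedding r.injective).isEmbedding.t2Space
  obtain ⟨β₀, κ, hβ₀, hκ, h⟩ :=
    SCFloor.sliceSum_one_floor r.ρ r.continuous (LatticeRep.exists_re_trace_ne hG r)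
  refine ⟨β₀, κ, 1, hβ₀, hκ, fun β hβ hββ₀ S hS => ?_⟩
  exact h S hS β hβ hββ₀

/-- **RUNG R2 OF LINE `momentum-pincer` — PROVED.**  `NoLightMoversSCTransfer` (verbatim the body of the registered stub
`Summit.QuantumFields.YangMills.Cruxes.IR.MomentumPincer.stub_noLightMoversSCTransfer`, skeleton v1.6) holds:
RP / transfer matrix (§1–§3) + F0 (§2b) + the `SCFloor` engine's landed slice floor (§5) + non-constancy of the real
character of a faithful representation of a compact simple group (§3d).  The skeleton's stub closes BY NAME as
`theorem stub_noLightMoversSCTransfer : NoLightMoversSCTransfer := MomentumPincerRung.noLightMoversSCTransfer_holds`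
(definitional unfolding of the verbatim copies `spatialVec`, `sliceSumCorr`).  HONEST: a strong-coupling rung; nothing
here bears on `IR` at weak coupling, a continuum limit, or the Yang–Mills mass gap. -/
theorem noLightMoversSCTransfer_holds : NoLightMoversSCTransfer :=
  noLightMoversSCTransfer_of_plaquetteSlicePowerFloorSC plaquetteSlicePowerFloorSC_holds

end Summit.QuantumFields.YangMills.Cruxes.IR.MomentumPincerRung

end
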